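import Literature.AnabelianGeometry.AbsoluteAnabelian.MonoidKummerMaps
import Literature.AnabelianGeometry.AbsoluteAnabelian.MLFGaloisModelPairs
import Literature.AnabelianGeometry.AbsoluteAnabelian.AbsTopIII.KummerFaithfulLocalFieldProofs
import Literature.AnabelianGeometry.EtaleTheta.KummerMapExactness
import Mathlib.FieldTheory.KrullTopology

/-!
# The Kummer theory of the MODEL `TM`-pair `(Π_k ↷ 𝒪_k̄^⊳)` ([AbsTopIII] Prop 3.2 (ii), (iii), Rmk 3.2.1,
# Prop 3.2 (v) — constructed / discharged RELATIVE TO THE MODEL)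

Companion of `MonoidKummerMaps.lean` (S. Mochizuki, *Topics in absolute anabelian geometry III*, §3,
Prop. 3.2 pp. 71–72; bib key `MochizukiAbsTopIII2015`, locators = kurims manuscript pages, lit key
`paper:url-5493eb38cbb7`).  There, Prop. 3.2 (i)–(iii) and Rmk. 3.2.1 are typed as the OUTPUT FIELDS of
the structure `MonoidKummerTheory P` over an abstract `TM`-pair `P = (Π ↷ M)` (with the interface
`ContCohomologyData` for the cohomology groups, marked TODO-construct).  This file CONSTRUCTS that
structure for the MODEL pair of Def. 3.1 (i) — `P = (Π_k ↷ 𝒪_k̄^⊳)` for model data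
`(k, k̄, ε_k : Π_k ↠ G_k)` (`MLFClosure` + `ModelMLFGaloisData`) — out of REAL objects:

* (in the first companion file `MLFGaloisModelPairs.lean`: the model pair `D.tmPair` as a named pair over
  the action instances `Π_k ↷ 𝒪_k̄^⊳, k̄ˣ`, `toUnit : 𝒪_k̄^⊳ → k̄ˣ`, rootability of `k̄ˣ`, and Rmk. 3.2.1 for
  the model: `MLFClosure.cyclotomeUnitsEquiv : μ_Ẑ(𝒪_k̄^⊳) = Λ((𝒪_k̄^⊳)ˣ) ⥲ Λ(k̄ˣ) = Ẑ(1)`, PROVED bijective);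
* `ModelMLFGaloisData.kummerCohomology : ContCohomologyData Π_k` — INHABITED by
  `H ↦ H¹(H, Λ(k̄ˣ))` := Mathlib's `groupCohomology.H1` of the `H`-module `Λ(k̄ˣ) = μ_Ẑ(k̄)` (seat
  abc-iut-L2-t3's `cyclotomeRep`), restriction := `EtaleTheta.resH1`, with `res_id` / `res_comp` from the
  tree's `EtaleTheta.resH1_self` / `resH1_trans` (`KummerMapExactness.lean`, seat abc-iut-c312-4);
* `ModelMLFGaloisData.kummerTheory : MonoidKummerTheory D.tmPair` — Prop. 3.2 (ii): `kummer H` := the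
  Kummer class `κ_H(m) ∈ H¹(H, Λ(k̄ˣ))` of `m ∈ (𝒪_k̄^⊳)^H` ("by considering the action of open subgroups
  `H ⊆ Π` on elements of `M_TM` that are roots of elements of `M^H_TM`" — literally: the class of the
  cocycle `h ↦ (h·m^{1/n}/m^{1/n})_n`, `EtaleTheta.kummerClass`), `kummer_mul`, `kummer_res`,
  `kummerLim`/`kummerLim_spec` PROVED; Rmk. 3.2.1: `cycIso := MLFClosure.cyclotomeUnitsEquiv`;
  Prop. 3.2 (iii): `addStr` := the inclusion `𝒪_k̄^⊳ ↪ k̄` (the field structure on "the image of the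
  Kummer map ∪ {0}"); also `ZHat.instCommGroup` (`Ẑ` is commutative, so that `ZhatAdd` is an additive
  commutative group, as the `H²` slot requires);
* `ModelMLFGaloisData.kummerTheory_recoversClosure` — Prop. 3.2 (v) at the level of objects
  (`MonoidKummerTheory.RecoversClosure`) PROVED for the model: the field of (iii) is `k̄` itself;
* `ModelMLFGaloisData.kummer_injective_of_isOpen` — the Kummer map `(𝒪_k̄^⊳)^H → H¹(H, Λ(k̄ˣ))` is
  INJECTIVE at every open `H ⊆ Π_k` with open image in `G_k` (all `H` when `ε_k` is an open map, e.g.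
  `Π_k` profinite): kernel = elements with an `H`-invariant compatible root system
  (`EtaleTheta.kummerClass_eq_zero_iff`) ⊆ `⋂ₙ (k'^×)ⁿ = {1}` for the finite level `k'` cut out by the
  image (`MLFClosure.eq_one_of_forall_pos_exists_pow_eq`, seat abc-iut-L6-t21) — the "Kummer-faithful"
  content of (ii) for MLF's ([AbsTopIII] Rmk. 1.5.4 (i)).

What is NOT modelled (honest gap).  Prop. 3.2 (i), the natural isomorphism `H²(G, μ_Ẑ(M_TM)) ⥲ Ẑ`
(local Brauer group / `G ↠ G^unr ⥲ Ẑ`, Cor. 1.10 (b)), is local class field theory in degree two; the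
interface `ContCohomologyData` leaves `H²` an unconstrained abelian group, and this file fills that
slot with `Ẑ` ITSELF and the identity (`h2Iso := AddEquiv.refl`), i.e. (i) is NOT discharged here
(the tree's level-`n` LCFT form is `LocalClassFieldTheoryForms.mlf_H2_mu_equiv_zmod`).  The field `muG`
("the cyclotome `μ_Ẑ(G)` of Cor. 1.10 (a)", seat abc-iut-L4-t1) is taken to be `Ẑ(1) = Λ(k̄ˣ)`: the
group-theoretic cyclotome of Cor. 1.10 (a) is not yet in the tree.  `H¹` is the cohomology of the
ABSTRACT group `H` with coefficients the discrete `H`-module `Λ(k̄ˣ)` (Mathlib has no continuous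
`H¹` by crossed homomorphisms); the Kummer classes are continuous (`EtaleTheta/KummerContH1.lean`).
Universe: the cohomological part is at universe `0` (Mathlib's `groupCohomology` is single-universe and
the named facts of `MonoidKummerMaps.lean` quantify over `GaloisMonoidPair.{0}`).

HONEST FRAMING: OUR kernel constructions/checks of classical Kummer theory as used by a refereed
paper; nothing here bears on [IUTchIII] Cor. 3.12; typed ≠ discharged — (i) stays typed only.
-/

noncomputable section

universe u

/-! ### `Ẑ` is commutative -/

/-- `Ẑ` (the tree's profinite completion of `ℤ`, `SemiGraphs.ZHat`) is commutative: componentwise in the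
finite quotients `ℤ/N` — so that its additive form `ZhatAdd` (the target of Prop. 3.2 (i)) is an additive
commutative group. [folklore] -/
instance Literature.AnabelianGeometry.SemiGraphs.ZHat.instCommGroup :
    CommGroup (Literature.AnabelianGeometry.SemiGraphs.ZHat : Type) :=
  { (inferInstance : Group (Literature.AnabelianGeometry.SemiGraphs.ZHat : Type)) with
    mul_comm := fun a b => by
      apply Subtype.ext
      funext N
      change a.val N * b.val N = b.val N * a.val N
      have key : ∀ p q : Multiplicative ℤ ⧸ N.toSubgroup, p * q = q * p :=
        fun p q => _root_.mul_comm p q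
      exact key (a.val N) (b.val N) }

namespace Literature.AnabelianGeometry.AbsoluteAnabelian

open _root_.Topology
open scoped _root_.ValuativeRel
open Literature.AnabelianGeometry.EtaleTheta (RootSystem cyclotomeRep kummerClass invariants resH1)

section Kummer

variable (C : MLFClosure.{0}) (D : ModelMLFGaloisData C.k C.K)

namespace ModelMLFGaloisData

/-- **The cohomology data of the model, INHABITED**: `H ↦ H¹(H, Λ(k̄ˣ))` (Mathlib `groupCohomology.H1` of
the `H`-module `Λ(k̄ˣ) = μ_Ẑ(k̄)`, seat abc-iut-L2-t3's `cyclotomeRep`) for open `H ⊆ Π_k`, with the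
restriction maps `EtaleTheta.resH1` (functorial: the tree's `resH1_self`, `resH1_trans`); the `H²` slot
is filled by `Ẑ` itself (Prop. 3.2 (i) is NOT modelled — see the module docstring).
[cite: MochizukiAbsTopIII2015, Proposition 3.2 (ii) p.71] -/
def kummerCohomology : ContCohomologyData D.tmPair.Pi where
  H1 H := groupCohomology.H1 (cyclotomeRep (A := (C.K)ˣ) (H : Subgroup D.Pi))
  res h := (resH1 (A := (C.K)ˣ) (G := D.Pi) (OpenSubgroup.toSubgroup_le.mpr h)).toAddMonoidHom
  res_id H := AddMonoidHom.ext fun x =>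
    EtaleTheta.resH1_self (A := (C.K)ˣ) (G := D.Pi) (H : Subgroup D.Pi) x
  res_comp h₁ h₂ := AddMonoidHom.ext fun x =>
    (EtaleTheta.resH1_trans (A := (C.K)ˣ) (G := D.Pi)
      (OpenSubgroup.toSubgroup_le.mpr h₁) (OpenSubgroup.toSubgroup_le.mpr h₂) x).symm
  H2 := ZhatAdd.{0}

/-- The `H`-invariant unit of `k̄` underlying an `H`-invariant non-zero integer.
[cite: MochizukiAbsTopIII2015, Proposition 3.2 (ii) p.71] -/
def invariantUnit (H : OpenSubgroup D.tmPair.Pi)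
    (m : {m : D.tmPair.M // ∀ h : H, (h : D.tmPair.Pi) • m = m}) :
    invariants (A := (C.K)ˣ) (H : Subgroup D.Pi) :=
  ⟨toUnit m.1, fun h => by
    change (h : D.Pi) • toUnit m.1 = toUnit m.1
    rw [D.smul_toUnit, m.2 ⟨h.1, h.2⟩]⟩

/-- `invariantUnit` on underlying units. [cite: MochizukiAbsTopIII2015, Proposition 3.2 (ii) p.71] -/
@[simp] theorem coe_invariantUnit (H : OpenSubgroup D.tmPair.Pi)
    (m : {m : D.tmPair.M // ∀ h : H, (h : D.tmPair.Pi) • m = m}) :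
    ((D.invariantUnit C H m : invariants (A := (C.K)ˣ) (H : Subgroup D.Pi)) : (C.K)ˣ) = toUnit m.1 :=
  rfl

/-- The open subgroup of `Π_k` stabilising `m ∈ 𝒪_k̄^⊳` (open by Def. 3.1 (i): stabilisers of the model
action are open). [cite: MochizukiAbsTopIII2015, Proposition 3.2 (ii) p.71] -/
def stabilizerOpen (m : D.tmPair.M) : OpenSubgroup D.tmPair.Pi :=
  ⟨MulAction.stabilizer D.Pi m, D.tmPair.isOpen_stabilizer m⟩

/-- Membership in `stabilizerOpen`. [cite: MochizukiAbsTopIII2015, Proposition 3.2 (ii) p.71] -/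
theorem mem_stabilizerOpen_iff (m : D.tmPair.M) (g : D.Pi) : g ∈ D.stabilizerOpen C m ↔ g • m = m :=
  MulAction.mem_stabilizer_iff

/-- **Prop 3.2 (ii), (iii), Rmk 3.2.1 for the model — the structure `MonoidKummerTheory (Π_k ↷ 𝒪_k̄^⊳)`
BUILT.**  `kummer H m` = the Kummer class `κ_H(m) ∈ H¹(H, Λ(k̄ˣ))` of the unit `m ∈ (𝒪_k̄^⊳)^H ⊆ (k̄ˣ)^H`
(class of `h ↦ (h·y_n/y_n)_n` for any compatible system of roots `y` of `m`; `EtaleTheta.kummerClass`);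
`kummerLim m` = its image in `lim→_J H¹(J, Λ)` computed at the stabiliser of `m`; `cycIso` =
`MLFClosure.cyclotomeUnitsEquiv`; `F := k̄`, `addStr := (𝒪_k̄^⊳ ⊆ k̄)`; `h2Iso := id_Ẑ` (gap, see above).
[cite: MochizukiAbsTopIII2015, Proposition 3.2 (ii) p.71] -/
def kummerTheory : MonoidKummerTheory D.tmPair where
  coh := D.kummerCohomology C
  h2Iso := AddEquiv.refl ZhatAdd.{0}
  muG := EtaleTheta.cyclotome (C.K)ˣ
  cycIso := C.cyclotomeUnitsEquiv
  kummer H m := kummerClass (A := (C.K)ˣ) (G := D.Pi) (H : Subgroup D.Pi) (D.invariantUnit C H m)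
  kummer_mul H m m' := by
    change kummerClass (A := (C.K)ˣ) (G := D.Pi) (H : Subgroup D.Pi) (D.invariantUnit C H _) =
      kummerClass (A := (C.K)ˣ) (G := D.Pi) (H : Subgroup D.Pi) (D.invariantUnit C H m) +
        kummerClass (A := (C.K)ˣ) (G := D.Pi) (H : Subgroup D.Pi) (D.invariantUnit C H m')
    rw [← EtaleTheta.kummerClass_mul]
    congr 1
    exact Subtype.ext (toUnit_mul m.1 m'.1)
  kummer_res {H J} hJH m := by
    change resH1 (A := (C.K)ˣ) (G := D.Pi) (OpenSubgroup.toSubgroup_le.mpr hJH)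
        (kummerClass (A := (C.K)ˣ) (G := D.Pi) (H : Subgroup D.Pi) ⟨toUnit m.1, _⟩) =
      kummerClass (A := (C.K)ˣ) (G := D.Pi) (J : Subgroup D.Pi) ⟨toUnit m.1, _⟩
    exact EtaleTheta.resH1_kummerClass _ _ _ _
  kummerLim m := Quot.mk _ ⟨D.stabilizerOpen C m,
    kummerClass (A := (C.K)ˣ) (G := D.Pi) (D.stabilizerOpen C m : Subgroup D.Pi)
      (D.invariantUnit C (D.stabilizerOpen C m)
        ⟨m, fun h => (D.mem_stabilizerOpen_iff C m h).mp h.2⟩)⟩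
  kummerLim_spec m H hm := by
    refine Quot.sound ⟨D.stabilizerOpen C m ⊓ H, inf_le_left, inf_le_right, ?_⟩
    have hinv : toUnit m ∈ invariants (A := (C.K)ˣ) ((D.stabilizerOpen C m ⊓ H :
        OpenSubgroup D.tmPair.Pi) : Subgroup D.Pi) := by
      intro h
      change (h : D.Pi) • toUnit m = toUnit m
      rw [D.smul_toUnit, hm ⟨h.1, (inf_le_right : D.stabilizerOpen C m ⊓ H ≤ H) h.2⟩]
    change resH1 (A := (C.K)ˣ) (G := D.Pi) _
        (kummerClass (A := (C.K)ˣ) (G := D.Pi) _ ⟨toUnit m, _⟩) =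
      resH1 (A := (C.K)ˣ) (G := D.Pi) _ (kummerClass (A := (C.K)ˣ) (G := D.Pi) _ ⟨toUnit m, _⟩)
    rw [EtaleTheta.resH1_kummerClass _ (toUnit m) _ hinv,
      EtaleTheta.resH1_kummerClass _ (toUnit m) _ hinv]
  F := C.K
  addStr := (nonzeroIntegers C.k C.K).subtype
  addStr_injective := Subtype.val_injective
  addStr_ne_zero m := m.2.2

/-- The Kummer map of the model at level `H`, unfolded: the Kummer class of the invariant unit.
[cite: MochizukiAbsTopIII2015, Proposition 3.2 (ii) p.71] -/
theorem kummerTheory_kummer (H : OpenSubgroup D.tmPair.Pi)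
    (m : {m : D.tmPair.M // ∀ h : H, (h : D.tmPair.Pi) • m = m}) :
    (D.kummerTheory C).kummer H m =
      kummerClass (A := (C.K)ˣ) (G := D.Pi) (H : Subgroup D.Pi) (D.invariantUnit C H m) :=
  rfl

/-- It may be computed with ANY compatible system of roots of `m` in `k̄ˣ` (class of the cocycle
`h ↦ (h • x_n / x_n)_n`). [cite: MochizukiAbsTopIII2015, Proposition 3.2 (ii) p.71] -/
theorem kummerTheory_kummer_eq_of_rootSystem (H : OpenSubgroup D.tmPair.Pi)
    (m : {m : D.tmPair.M // ∀ h : H, (h : D.tmPair.Pi) • m = m}) (x : RootSystem (toUnit m.1)) :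
    (D.kummerTheory C).kummer H m =
      EtaleTheta.kummerClassOfRootSystem (A := (C.K)ˣ) (G := D.Pi) (H : Subgroup D.Pi) x
        (D.invariantUnit C H m).2 :=
  EtaleTheta.kummerClass_eq_of_rootSystem (A := (C.K)ˣ) (G := D.Pi) (H : Subgroup D.Pi)
    (D.invariantUnit C H m) x

/-- **Prop 3.2 (v) at the level of objects, for the model**: the field of (iii) recovers `k̄` — with
`F = k̄` and `addStr` the inclusion, `RecoversClosure` holds via the identity of `k̄` (and the range of the
inclusion is `𝒪_k̄^⊳`). [cite: MochizukiAbsTopIII2015, Proposition 3.2 (v) p.72] -/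
theorem kummerTheory_recoversClosure :
    (D.kummerTheory C).RecoversClosure C (fun m : D.tmPair.M => (m : C.K)) := by
  refine ⟨RingEquiv.refl _, fun _ => rfl, Set.ext fun x => ⟨?_, fun hx => ⟨⟨x, hx⟩, rfl⟩⟩⟩
  rintro ⟨m, rfl⟩
  exact m.2

/-! ### Injectivity of the Kummer map ("Kummer-faithfulness" of MLF's) -/

/-- **The Kummer map of the model is injective** at every open `H ⊆ Π_k` whose image `ε_k(H) ⊆ G_k` is
open: if `κ_H(m) = κ_H(m')` then `m/m'` has a compatible system of roots fixed by `H`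
(`EtaleTheta.kummerClass_eq_zero_iff`), hence lying, with `m/m'`, in the finite extension `k' ⊆ k̄` of `k`
cut out by an open subgroup of `G_k` inside `ε_k(H)` (Krull topology); so `m/m' ∈ ⋂ₙ (k'^×)ⁿ = {1}`
(`MLFClosure.eq_one_of_forall_pos_exists_pow_eq`: `k'` is again a non-archimedean local field).
[cite: MochizukiAbsTopIII2015, Proposition 3.2 (ii) p.71] -/
theorem kummer_injective_of_isOpen (H : OpenSubgroup D.tmPair.Pi)
    (hH : IsOpen (((H : Subgroup D.Pi).map D.aug : Subgroup (C.K ≃ₐ[C.k] C.K)) :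
      Set (C.K ≃ₐ[C.k] C.K))) :
    Function.Injective ((D.kummerTheory C).kummer H) := by
  -- injectivity of the Kummer map on the GROUP of `H`-invariant units
  have hinj : Function.Injective
      (EtaleTheta.kummerMapFixed (A := (C.K)ˣ) (G := D.Pi) (H : Subgroup D.Pi)) := by
    refine EtaleTheta.kummerMapFixed_injective_of_iInter_pow_eq_bot _ fun a ha => ?_
    -- the finite level `E` inside the open image
    have h1 : (((H : Subgroup D.Pi).map D.aug : Subgroup (C.K ≃ₐ[C.k] C.K)) : Set (C.K ≃ₐ[C.k] C.K))
        ∈ 𝓝 (1 : C.K ≃ₐ[C.k] C.K) := hH.mem_nhds (Subgroup.one_mem _)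
    obtain ⟨E, hEfin, hEsub⟩ := (krullTopology_mem_nhds_one_iff C.k C.K _).mp h1
    haveI : FiniteDimensional C.k E := hEfin
    -- an `H`-invariant unit lies in `E`
    have hmemE : ∀ b : invariants (A := (C.K)ˣ) (H : Subgroup D.Pi), ((b : (C.K)ˣ) : C.K) ∈ E := by
      intro b
      rw [← InfiniteGalois.fixedField_fixingSubgroup E, IntermediateField.mem_fixedField_iff]
      intro σ hσ
      obtain ⟨g, hg, rfl⟩ := hEsub hσ
      have hb : g • (b : (C.K)ˣ) = b := b.2 ⟨g, hg⟩
      have hb' : D.aug g • ((b : (C.K)ˣ) : C.K) = (b : (C.K)ˣ) := by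
        rw [← D.units_coe_smul, hb]
      simpa [AlgEquiv.smul_def] using hb'
    have ha1 : ((a : (C.K)ˣ) : C.K) = 1 := by
      refine MLFClosure.eq_one_of_forall_pos_exists_pow_eq C E (hmemE a) (a : (C.K)ˣ).ne_zero
        fun n hn => ?_
      obtain ⟨b, hb⟩ := ha ⟨n, hn⟩
      refine ⟨((b : (C.K)ˣ) : C.K), hmemE b, ?_⟩
      have := congrArg (fun u : invariants (A := (C.K)ˣ) (H : Subgroup D.Pi) => ((u : (C.K)ˣ) : C.K)) hb
      simpa [Units.val_pow_eq_pow_val] using this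
    exact Subtype.ext (Units.ext ha1)
  intro m m' hmm'
  have h := hinj (a₁ := Additive.ofMul (D.invariantUnit C H m))
    (a₂ := Additive.ofMul (D.invariantUnit C H m')) hmm'
  have h' : toUnit m.1 = toUnit m'.1 :=
    congrArg (fun u : invariants (A := (C.K)ˣ) (H : Subgroup D.Pi) => (u : (C.K)ˣ))
      (Additive.ofMul.injective h)
  exact Subtype.ext (toUnit_injective h')

/-- In particular, if `ε_k : Π_k ↠ G_k` is an OPEN map (e.g. `Π_k` profinite — a continuous surjection
of profinite groups is open), the Kummer map of the model is injective at EVERY open `H ⊆ Π_k`.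
[cite: MochizukiAbsTopIII2015, Proposition 3.2 (ii) p.71] -/
theorem kummer_injective (hε : IsOpenMap D.aug) (H : OpenSubgroup D.tmPair.Pi) :
    Function.Injective ((D.kummerTheory C).kummer H) :=
  D.kummer_injective_of_isOpen C H (by
    rw [Subgroup.coe_map]
    exact hε _ H.isOpen)

end ModelMLFGaloisData

/-- **Non-vacuity of `MonoidKummerTheory`** on MLF-Galois `TM`-pairs: the model pair of any model data
carries the Kummer theory constructed above. [cite: MochizukiAbsTopIII2015, Proposition 3.2 (ii) p.71] -/
theorem nonempty_monoidKummerTheory_tmPair : Nonempty (MonoidKummerTheory D.tmPair) :=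
  ⟨D.kummerTheory C⟩

end Kummer

end Literature.AnabelianGeometry.AbsoluteAnabelian

end
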